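import Summits.QuantumFields.BalabanUV.T4Continuum.Support.DirichletSplitVertex

/-!
# `BalabanUV.T4Continuum.Support.DirichletLocalisedBesov` — NE2 (node U1a) formalisation swarm, SUPPLIER item «Δ1-LOCAL» under the
# owner's sub-row `T4-U1a.S-NE2-D1-DIRICHLET°` (wall `hinj`): THE LOCALISED ONE-SIDED BESOV ESTIMATE — directional `B^{1/2}_{2,∞}`
# regularity of the gradient up to the boundary for a lattice field supported in the block region of a LOCALLY SPLITTABLE block set
# (unit b2b-balaban-t4-ne2-formalise-leaf-08, gen 5, file 3 of 4)

HONEST FRAMING.  Rung (B)+1 bookkeeping at MODEL level (U = 1 scalar layer), finite torus; NE2 (U1a) is NOT proved by this file; spine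
PROVED 0/9 unchanged; NOT infinite volume, NOT the mass gap, NOT Clay.  HONEST DEPENDENCY (verbatim): «continuum YM on T⁴ ⇐ BetaPertH ∧
nine spine estimates (0/9 proved); BetaPertH ⇐ (D1) ∧ (D4) ∧ CAP+tail; G-an2-4 gates asym, D1 and NE2/3/4.»

THE METHOD ([folklore]: Nirenberg ∕ Savaré admissible translations, localised by a partition of unity — nothing printed is a hypothesis).
Module (I) of gen 3 (`DirichletDirectionalBesov.nsq_sdiff_sdiff_le_of_admissible`) gives, for ANY field `w` whose one-sided translate
`T_{±e_μ}w − w` is supported in a region on which `Δw` is known: `‖∂_μ∂_μ w‖² ≤ 2‖c‖·√(Σ_ν‖∂_νw‖²)·‖1_{region}Δw‖`.  Here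
`w` runs over the PIECES of files 1–2 (`DirichletSplitPieces`, `DirichletSplitVertex`): `z = Σ_v bump_v·z` (module (II)'s exact partition of unity
`DirichletMonotoneCutoff.sum_bump`) and, at each vertex `v`, `bump_v·z = piece_D + piece_U` along the 2-colouring of
`SplittableAt S v μ`; `piece_D` is admissible for `+e_μ` on its own blocks, `piece_U` for `−e_μ`, their gradients are dominated POINTWISE by those of
`bump_v·z` and their Laplacians AGREE with `Δ(bump_v·z)` on their own blocks — so each vertex costs `8‖c‖·√E(bump_v z)·‖1_ΩΔ(bump_v z)‖`
(file 2 §4).  The vertex pieces have BOUNDED OVERLAP (a second difference at `x` sees only the `≤ 3·2^d` vertices whose patches contain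
the blocks of `x, x+e_μ, x+2e_μ`, file 2 §3), and the bump costs are SUMMABLE over the vertices by module (II)'s summed difference bounds
(`sum_abs_bump_sub_le`, `sum_abs_bump_second_le`: `Σ_v|δbump_v| ≤ 3/(n−1)`, `Σ_v|δ²bump_v| ≤ 12/(n−1)²`, §1 here), whence THE END (§2)

  **`nsq (∂_μᴴ∂_μ z) ≤ 24·2^d·‖c‖ · √(2E(z) + 2d‖c‖²ℓ₁²‖z‖²) · √(2‖1_ΩΔz‖² + 16d‖c‖²ℓ₁²E(z) + 4d²‖c‖⁴ℓ₂²‖z‖²)`**,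
  `ℓ₁ = 3/(n−1)`, `ℓ₂ = 12/(n−1)²`,

for EVERY field `z` supported in `Ω` (`Ω ↔ blockReg n M S` pointwise) and every axis `μ` along which `S` is splittable at every vertex —
ONE power of `‖c‖` against the datum, exactly the budget of module (I)'s END, with NO global cutoff.  File 3 feeds it to gan24-p2's
(C-glob) pairing bound exactly as module (III) did.

ABSOLUTE RULE (cell, verbatim): «No internally-minted statement may enter as a cited fact. Every hypothesis is either kernel-proved in
this package or a verbatim quotation of a PUBLISHED theorem with page reference. The manuscript(s) under audit are NOT citable for
their own disputed steps — they are the thing under adjudication; programme-internal (2001/route/tribunal) claims are never citable.»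
[folklore] finite lattice calculus; no `def … : Prop` fact; the only hypothesis of the END is the shape predicate `SplittableAt` at every
vertex.  NOT CLAIMED: non-splittable patches (the spiral 4-chain); the VECTOR operator; rate `L^{−1}`; NE2; NE3; «not in print; our proof».
-/

noncomputable section

open scoped BigOperators ComplexConjugate Matrix
open Finset

namespace Summit.QuantumFields.BalabanUV.T4Continuum.DirichletLocalisedBesov

open Literature.MathematicalPhysics.QuantumFieldTheory.Balaban1983to89.B5Prop11Plancherel (Tor fine unitVec)
open Literature.MathematicalPhysics.QuantumFieldTheory.Balaban1983to89.B5Action121 (sdiff LapS sdiff_mulVec LapS_mulVec)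
open Literature.MathematicalPhysics.QuantumFieldTheory.Balaban1983to89.B5Prop11Lower (nsq nsq_nonneg)
open Literature.MathematicalPhysics.QuantumFieldTheory.Balaban1983to89.B5Blocks16 (blockOf)
open Summit.QuantumFields.BalabanUV.T4Continuum.ScalarBlockPoincare (nsq_add_le nsq_smul transS nsq_transS)
open Summit.QuantumFields.BalabanUV.T4Continuum.DirichletDirectionalBesov (nsq_mono nsqOn nsqOn_nonneg restrictTo nsq_restrictTo
  nsq_sdiff_sdiff_le_of_admissible)
open Summit.QuantumFields.BalabanUV.T4Continuum.DirichletDirectionalBesovCutoff (cut sdiff_cut LapS_cut energy energy_nonneg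
  transl_sub_transl_eq nsq_sdiffH_sdiff_eq)
open Summit.QuantumFields.BalabanUV.T4Continuum.DirichletMonotoneCutoff (bump bump_mem sum_bump sum_abs_bump_sub_le
  sum_abs_bump_second_le pred_pos inPatch_of_bump_ne_zero InPatch)
open Summit.QuantumFields.BalabanUV.T4Continuum.DirichletSplitPieces (SplittableAt vfield)
open Summit.QuantumFields.BalabanUV.T4Continuum.DirichletSplitVertex (nsq_sum_le_of_overlap sum_sqrt_mul_sqrt_le
  tripleVerts card_tripleVerts_le mem_tripleVerts_of_ne_zero nsq_sdiff_sdiff_vfield_le)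

variable {d : ℕ}

/-! ## §1 The bump costs, summed over the vertices -/

section Sums

variable (n : ℕ) [NeZero n] (M : Fin d → ℕ) [hM : ∀ μ, NeZero (M μ)]

/-- the unit-scale smoothness constants of the bumps: `ℓ₁ = 3/(n−1)`. [folklore] -/
def ell1 (n : ℕ) : ℝ := 3 * (1 / ((n : ℝ) - 1))

/-- `ℓ₂ = 12/(n−1)²`. [folklore] -/
def ell2 (n : ℕ) : ℝ := 12 * (1 / ((n : ℝ) - 1)) ^ 2

/-- `Σ_v bump_v(y)² ≤ 1`. [folklore] -/
theorem sum_bump_sq_le_one (hn : 2 ≤ n) (y : Tor (fine n M)) : ∑ v : Tor M, bump n M v y ^ 2 ≤ 1 := by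
  calc ∑ v : Tor M, bump n M v y ^ 2 ≤ ∑ v : Tor M, bump n M v y := Finset.sum_le_sum fun v _ => by
          have h := bump_mem n M hn v y; nlinarith [h.1, h.2]
    _ = 1 := sum_bump n M y

/-- `Σ_v (bump_v(x + e_ν) − bump_v x)² ≤ ℓ₁²`. [folklore] -/
theorem sum_bump_sub_sq_le (hn : 2 ≤ n) (x : Tor (fine n M)) (ν : Fin d) :
    ∑ v : Tor M, (bump n M v (x + unitVec (fine n M) ν) - bump n M v x) ^ 2 ≤ ell1 n ^ 2 := by
  calc ∑ v : Tor M, (bump n M v (x + unitVec (fine n M) ν) - bump n M v x) ^ 2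
      = ∑ v : Tor M, |bump n M v (x + unitVec (fine n M) ν) - bump n M v x| ^ 2 :=
        Finset.sum_congr rfl fun v _ => (sq_abs _).symm
    _ ≤ (∑ v : Tor M, |bump n M v (x + unitVec (fine n M) ν) - bump n M v x|) ^ 2 :=
        sum_sq_le_sq_sum_of_nonneg fun v _ => abs_nonneg _
    _ ≤ ell1 n ^ 2 := by
        have h := sum_abs_bump_sub_le n M hn x ν
        have h0 : 0 ≤ ∑ v : Tor M, |bump n M v (x + unitVec (fine n M) ν) - bump n M v x| := Finset.sum_nonneg fun _ _ => abs_nonneg _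
        rw [ell1]; exact pow_le_pow_left₀ h0 h 2

/-- `Σ_v (2bump_v x − bump_v(x + e_ν) − bump_v(x − e_ν))² ≤ ℓ₂²`. [folklore] -/
theorem sum_bump_second_sq_le (hn : 2 ≤ n) (x : Tor (fine n M)) (ν : Fin d) :
    ∑ v : Tor M, (2 * bump n M v x - bump n M v (x + unitVec (fine n M) ν) - bump n M v (x - unitVec (fine n M) ν)) ^ 2
      ≤ ell2 n ^ 2 := by
  calc ∑ v : Tor M, (2 * bump n M v x - bump n M v (x + unitVec (fine n M) ν) - bump n M v (x - unitVec (fine n M) ν)) ^ 2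
      = ∑ v : Tor M, |2 * bump n M v x - bump n M v (x + unitVec (fine n M) ν) - bump n M v (x - unitVec (fine n M) ν)| ^ 2 :=
        Finset.sum_congr rfl fun v _ => (sq_abs _).symm
    _ ≤ (∑ v : Tor M, |2 * bump n M v x - bump n M v (x + unitVec (fine n M) ν) - bump n M v (x - unitVec (fine n M) ν)|) ^ 2 :=
        sum_sq_le_sq_sum_of_nonneg fun v _ => abs_nonneg _
    _ ≤ ell2 n ^ 2 := by
        have h := sum_abs_bump_second_le n M hn x ν
        have h0 : 0 ≤ ∑ v : Tor M, |2 * bump n M v x - bump n M v (x + unitVec (fine n M) ν) - bump n M v (x - unitVec (fine n M) ν)| :=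
          Finset.sum_nonneg fun _ _ => abs_nonneg _
        rw [ell2]; exact pow_le_pow_left₀ h0 h 2

/-- **SUMMED ENERGY OF THE VERTEX FIELDS**: `Σ_v E(bump_v·z) ≤ 2E(z) + 2d‖c‖²ℓ₁²‖z‖²`. [folklore] -/
theorem sum_energy_vfield_le (hn : 2 ≤ n) (c : ℂ) (z : Tor (fine n M) → ℂ) :
    ∑ v : Tor M, energy (fine n M) c (vfield n M v z) ≤ 2 * energy (fine n M) c z + 2 * d * ‖c‖ ^ 2 * ell1 n ^ 2 * nsq z := by
  -- pointwise in (ν, x), summed over v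
  have hpt : ∀ (ν : Fin d) (x : Tor (fine n M)),
      ∑ v : Tor M, ‖(sdiff (fine n M) c ν *ᵥ vfield n M v z) x‖ ^ 2
        ≤ 2 * ‖(sdiff (fine n M) c ν *ᵥ z) x‖ ^ 2 + 2 * ‖c‖ ^ 2 * ell1 n ^ 2 * ‖z x‖ ^ 2 := by
    intro ν x
    have hform : ∀ v : Tor M, (sdiff (fine n M) c ν *ᵥ vfield n M v z) x
        = (bump n M v (x + unitVec (fine n M) ν) : ℂ) * (sdiff (fine n M) c ν *ᵥ z) x
          + c * (((bump n M v (x + unitVec (fine n M) ν) - bump n M v x : ℝ) : ℂ) * z x) := by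
      intro v
      have h := congr_fun (sdiff_cut (fine n M) c ν (bump n M v) z) x
      simpa [vfield, cut, Pi.add_apply, Pi.smul_apply, smul_eq_mul, mul_assoc] using h
    calc ∑ v : Tor M, ‖(sdiff (fine n M) c ν *ᵥ vfield n M v z) x‖ ^ 2
        ≤ ∑ v : Tor M, (2 * (bump n M v (x + unitVec (fine n M) ν) ^ 2 * ‖(sdiff (fine n M) c ν *ᵥ z) x‖ ^ 2)
            + 2 * (‖c‖ ^ 2 * ((bump n M v (x + unitVec (fine n M) ν) - bump n M v x) ^ 2 * ‖z x‖ ^ 2))) :=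
          Finset.sum_le_sum fun v _ => by
            rw [hform v]
            have hab : ∀ a b : ℂ, ‖a + b‖ ^ 2 ≤ 2 * ‖a‖ ^ 2 + 2 * ‖b‖ ^ 2 := fun a b =>
              calc ‖a + b‖ ^ 2 ≤ (‖a‖ + ‖b‖) ^ 2 := pow_le_pow_left₀ (norm_nonneg _) (norm_add_le a b) 2
                _ ≤ 2 * ‖a‖ ^ 2 + 2 * ‖b‖ ^ 2 := by nlinarith [sq_nonneg (‖a‖ - ‖b‖)]
            refine (hab _ _).trans (le_of_eq ?_)
            rw [norm_mul, norm_mul, norm_mul, Complex.norm_real, Complex.norm_real, Real.norm_eq_abs, Real.norm_eq_abs,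
              abs_of_nonneg (bump_mem n M hn v _).1, mul_pow, mul_pow, mul_pow, sq_abs]
      _ = 2 * (∑ v : Tor M, bump n M v (x + unitVec (fine n M) ν) ^ 2) * ‖(sdiff (fine n M) c ν *ᵥ z) x‖ ^ 2
            + 2 * ‖c‖ ^ 2 * (∑ v : Tor M, (bump n M v (x + unitVec (fine n M) ν) - bump n M v x) ^ 2) * ‖z x‖ ^ 2 := by
          rw [Finset.sum_add_distrib, ← Finset.mul_sum, ← Finset.mul_sum, ← Finset.sum_mul, ← Finset.mul_sum, ← Finset.sum_mul]; ring
      _ ≤ 2 * 1 * ‖(sdiff (fine n M) c ν *ᵥ z) x‖ ^ 2 + 2 * ‖c‖ ^ 2 * ell1 n ^ 2 * ‖z x‖ ^ 2 := by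
          gcongr
          · exact sum_bump_sq_le_one n M hn _
          · exact sum_bump_sub_sq_le n M hn x ν
      _ = _ := by ring
  calc ∑ v : Tor M, energy (fine n M) c (vfield n M v z)
      = ∑ ν : Fin d, ∑ x : Tor (fine n M), ∑ v : Tor M, ‖(sdiff (fine n M) c ν *ᵥ vfield n M v z) x‖ ^ 2 := by
        unfold energy nsq
        rw [Finset.sum_comm]
        exact Finset.sum_congr rfl fun ν _ => Finset.sum_comm
    _ ≤ ∑ ν : Fin d, ∑ x : Tor (fine n M), (2 * ‖(sdiff (fine n M) c ν *ᵥ z) x‖ ^ 2 + 2 * ‖c‖ ^ 2 * ell1 n ^ 2 * ‖z x‖ ^ 2) :=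
        Finset.sum_le_sum fun ν _ => Finset.sum_le_sum fun x _ => hpt ν x
    _ = 2 * energy (fine n M) c z + 2 * d * ‖c‖ ^ 2 * ell1 n ^ 2 * nsq z := by
        unfold energy nsq
        simp only [Finset.sum_add_distrib, ← Finset.mul_sum, Finset.sum_const, Finset.card_univ, Fintype.card_fin, nsmul_eq_mul]
        ring

/-- `Σ_x ‖z(x + e_ν) − z(x − e_ν)‖² ≤ 4‖c‖⁻²·‖∂_ν z‖²` (`c ≠ 0`). [folklore] -/
theorem nsq_transl_sub_transl_le (c : ℂ) (hc : c ≠ 0) (ν : Fin d) (z : Tor (fine n M) → ℂ) :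
    nsq (fun x => z (x + unitVec (fine n M) ν) - z (x - unitVec (fine n M) ν)) ≤ 4 * ‖c‖⁻¹ ^ 2 * nsq (sdiff (fine n M) c ν *ᵥ z) := by
  rw [transl_sub_transl_eq (fine n M) c hc ν z, nsq_smul, norm_inv]
  have h := nsq_add_le (sdiff (fine n M) c ν *ᵥ z) (transS (fine n M) (-unitVec (fine n M) ν) (sdiff (fine n M) c ν *ᵥ z))
  rw [nsq_transS] at h
  nlinarith [h, sq_nonneg ‖c‖⁻¹, nsq_nonneg (sdiff (fine n M) c ν *ᵥ z)]

/-- **SUMMED COMPRESSED LAPLACIANS OF THE VERTEX FIELDS**: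
`Σ_v ‖1_ΩΔ(bump_v·z)‖² ≤ 2‖1_ΩΔz‖² + 16d‖c‖²ℓ₁²E(z) + 4d²‖c‖⁴ℓ₂²‖z‖²` (`c ≠ 0`, `2 ≤ n`). [folklore] -/
theorem sum_nsqOn_LapS_vfield_le (hn : 2 ≤ n) (Ω : Tor (fine n M) → Prop) [DecidablePred Ω] (c : ℂ) (hc : c ≠ 0)
    (z : Tor (fine n M) → ℂ) :
    ∑ v : Tor M, nsqOn Ω (LapS (fine n M) c *ᵥ vfield n M v z)
      ≤ 2 * nsqOn Ω (LapS (fine n M) c *ᵥ z) + 16 * d * ‖c‖ ^ 2 * ell1 n ^ 2 * energy (fine n M) c z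
          + 4 * d ^ 2 * ‖c‖ ^ 4 * ell2 n ^ 2 * nsq z := by
  -- the two commutator amplitudes at a site
  set A : Fin d → Tor (fine n M) → ℝ := fun ν x => ‖z (x + unitVec (fine n M) ν) - z (x - unitVec (fine n M) ν)‖ with hA
  set B : Fin d → Tor (fine n M) → ℝ := fun ν x => ‖z (x - unitVec (fine n M) ν)‖ with hB
  have hA0 : ∀ ν x, 0 ≤ A ν x := fun _ _ => norm_nonneg _
  have hB0 : ∀ ν x, 0 ≤ B ν x := fun _ _ => norm_nonneg _
  have hℓ₁ : 0 ≤ ell1 n := by unfold ell1; have := pred_pos hn; positivity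
  have hℓ₂ : 0 ≤ ell2 n := by unfold ell2; positivity
  -- pointwise bound at a site, summed over the vertices
  have hpt : ∀ x : Tor (fine n M), ∑ v : Tor M, ‖restrictTo Ω (LapS (fine n M) c *ᵥ vfield n M v z) x‖ ^ 2
      ≤ 2 * ‖restrictTo Ω (LapS (fine n M) c *ᵥ z) x‖ ^ 2
        + 4 * d * ‖c‖ ^ 4 * ∑ ν : Fin d, (ell1 n ^ 2 * A ν x ^ 2 + ell2 n ^ 2 * B ν x ^ 2) := by
    intro x
    by_cases hx : Ω x
    swap
    · have h0 : ∀ v : Tor M, ‖restrictTo Ω (LapS (fine n M) c *ᵥ vfield n M v z) x‖ ^ 2 = 0 := fun v => by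
        simp [restrictTo, hx]
      rw [Finset.sum_congr rfl fun v _ => h0 v, Finset.sum_const_zero]
      have : 0 ≤ ∑ ν : Fin d, (ell1 n ^ 2 * A ν x ^ 2 + ell2 n ^ 2 * B ν x ^ 2) := Finset.sum_nonneg fun ν _ => by positivity
      positivity
    -- on `Ω`: `Δ(bump_v z)(x) = bump_v(x)·Δz(x) + S_v(x)` with `|S_v(x)| ≤ Σ_ν ‖c‖²(α_{vν} A_ν + β_{vν} B_ν)`
    set α : Tor M → Fin d → ℝ := fun v ν => |bump n M v x - bump n M v (x + unitVec (fine n M) ν)| with hα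
    set β : Tor M → Fin d → ℝ := fun v ν =>
      |2 * bump n M v x - bump n M v (x + unitVec (fine n M) ν) - bump n M v (x - unitVec (fine n M) ν)| with hβ
    set s : Tor M → ℝ := fun v => ∑ ν : Fin d, ‖c‖ ^ 2 * (α v ν * A ν x + β v ν * B ν x) with hs
    set L : ℝ := ‖(LapS (fine n M) c *ᵥ z) x‖ with hL
    have hdec : ∀ v : Tor M, ‖restrictTo Ω (LapS (fine n M) c *ᵥ vfield n M v z) x‖ ≤ bump n M v x * L + s v := by
      intro v
      have hid := congr_fun (LapS_cut (fine n M) c (bump n M v) z) x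
      simp only [restrictTo, if_pos hx]
      rw [show vfield n M v z = cut (fine n M) (bump n M v) z from rfl, hid, Pi.add_apply]
      refine (norm_add_le _ _).trans (add_le_add ?_ ?_)
      · simp only [cut]
        rw [norm_mul, Complex.norm_real, Real.norm_eq_abs, abs_of_nonneg (bump_mem n M hn v x).1]
      · rw [Finset.sum_apply]
        refine (norm_sum_le _ _).trans (Finset.sum_le_sum fun ν _ => ?_)
        simp only [Pi.add_apply, Pi.smul_apply, smul_eq_mul]
        rw [norm_mul, norm_mul, Complex.norm_conj, ← sq]
        refine mul_le_mul_of_nonneg_left ((norm_add_le _ _).trans (add_le_add ?_ ?_)) (sq_nonneg _)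
        · rw [norm_mul, Complex.norm_real, Real.norm_eq_abs]
        · rw [norm_mul, Complex.norm_real, Real.norm_eq_abs]
    have hs0 : ∀ v, 0 ≤ s v := fun v => Finset.sum_nonneg fun ν _ => by positivity
    -- the vertex sums of the bump coefficients
    have hsum_s : ∑ v : Tor M, s v ≤ ∑ ν : Fin d, ‖c‖ ^ 2 * (ell1 n * A ν x + ell2 n * B ν x) := by
      rw [hs, Finset.sum_comm]
      refine Finset.sum_le_sum fun ν _ => ?_
      rw [← Finset.mul_sum, Finset.sum_add_distrib, ← Finset.sum_mul, ← Finset.sum_mul]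
      refine mul_le_mul_of_nonneg_left (add_le_add (mul_le_mul_of_nonneg_right ?_ (hA0 ν x))
        (mul_le_mul_of_nonneg_right ?_ (hB0 ν x))) (sq_nonneg _)
      · refine le_trans (le_of_eq (Finset.sum_congr rfl fun v _ => abs_sub_comm _ _)) ?_
        rw [ell1]; exact sum_abs_bump_sub_le n M hn x ν
      · rw [ell2]; exact sum_abs_bump_second_le n M hn x ν
    calc ∑ v : Tor M, ‖restrictTo Ω (LapS (fine n M) c *ᵥ vfield n M v z) x‖ ^ 2
        ≤ ∑ v : Tor M, (bump n M v x * L + s v) ^ 2 := Finset.sum_le_sum fun v _ =>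
          pow_le_pow_left₀ (norm_nonneg _) (hdec v) 2
      _ ≤ ∑ v : Tor M, (2 * (bump n M v x ^ 2 * L ^ 2) + 2 * s v ^ 2) := Finset.sum_le_sum fun v _ => by
          nlinarith [sq_nonneg (bump n M v x * L - s v)]
      _ = 2 * (∑ v : Tor M, bump n M v x ^ 2) * L ^ 2 + 2 * ∑ v : Tor M, s v ^ 2 := by
          rw [Finset.sum_add_distrib, ← Finset.mul_sum, ← Finset.mul_sum, ← Finset.sum_mul]; ring
      _ ≤ 2 * 1 * L ^ 2 + 2 * (∑ v : Tor M, s v) ^ 2 := by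
          gcongr
          · exact sum_bump_sq_le_one n M hn x
          · exact sum_sq_le_sq_sum_of_nonneg fun v _ => hs0 v
      _ ≤ 2 * L ^ 2 + 2 * (∑ ν : Fin d, ‖c‖ ^ 2 * (ell1 n * A ν x + ell2 n * B ν x)) ^ 2 := by
          rw [mul_one]
          have h0 : 0 ≤ ∑ v : Tor M, s v := Finset.sum_nonneg fun v _ => hs0 v
          have h1 := pow_le_pow_left₀ h0 hsum_s 2
          linarith
      _ ≤ 2 * L ^ 2 + 2 * (d * ∑ ν : Fin d, (‖c‖ ^ 2 * (ell1 n * A ν x + ell2 n * B ν x)) ^ 2) := by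
          gcongr
          have h := sq_sum_le_card_mul_sum_sq (s := (Finset.univ : Finset (Fin d)))
            (f := fun ν => ‖c‖ ^ 2 * (ell1 n * A ν x + ell2 n * B ν x))
          rwa [Finset.card_univ, Fintype.card_fin] at h
      _ ≤ 2 * L ^ 2 + 2 * (d * ∑ ν : Fin d, ‖c‖ ^ 4 * (2 * (ell1 n ^ 2 * A ν x ^ 2) + 2 * (ell2 n ^ 2 * B ν x ^ 2))) := by
          gcongr with ν
          rw [mul_pow, ← pow_mul]
          refine mul_le_mul_of_nonneg_left ?_ (by positivity)
          nlinarith [sq_nonneg (ell1 n * A ν x - ell2 n * B ν x)]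
      _ = 2 * ‖restrictTo Ω (LapS (fine n M) c *ᵥ z) x‖ ^ 2
            + 4 * d * ‖c‖ ^ 4 * ∑ ν : Fin d, (ell1 n ^ 2 * A ν x ^ 2 + ell2 n ^ 2 * B ν x ^ 2) := by
          simp only [restrictTo, if_pos hx, hL, Finset.mul_sum]
          congr 1
          refine Finset.sum_congr rfl fun ν _ => ?_
          ring
  -- sum over the sites
  have hAsum : ∀ ν : Fin d, ∑ x : Tor (fine n M), A ν x ^ 2 ≤ 4 * ‖c‖⁻¹ ^ 2 * nsq (sdiff (fine n M) c ν *ᵥ z) := fun ν =>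
    nsq_transl_sub_transl_le n M c hc ν z
  have hBsum : ∀ ν : Fin d, ∑ x : Tor (fine n M), B ν x ^ 2 = nsq z := fun ν => by
    have : (fun x => z (x - unitVec (fine n M) ν)) = transS (fine n M) (-unitVec (fine n M) ν) z := by
      funext x; simp [transS, sub_eq_add_neg]
    rw [hB]; simp only []
    rw [show (∑ x : Tor (fine n M), ‖z (x - unitVec (fine n M) ν)‖ ^ 2) = nsq (fun x => z (x - unitVec (fine n M) ν)) from rfl,
      this, nsq_transS]
  have hcc : ‖c‖ ^ 4 * ‖c‖⁻¹ ^ 2 = ‖c‖ ^ 2 := by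
    have hc0 : ‖c‖ ≠ 0 := norm_ne_zero_iff.mpr hc
    field_simp
  calc ∑ v : Tor M, nsqOn Ω (LapS (fine n M) c *ᵥ vfield n M v z)
      = ∑ x : Tor (fine n M), ∑ v : Tor M, ‖restrictTo Ω (LapS (fine n M) c *ᵥ vfield n M v z) x‖ ^ 2 := by
        rw [Finset.sum_comm]
        exact Finset.sum_congr rfl fun v _ => by rw [← nsq_restrictTo]; rfl
    _ ≤ ∑ x : Tor (fine n M), (2 * ‖restrictTo Ω (LapS (fine n M) c *ᵥ z) x‖ ^ 2
          + 4 * d * ‖c‖ ^ 4 * ∑ ν : Fin d, (ell1 n ^ 2 * A ν x ^ 2 + ell2 n ^ 2 * B ν x ^ 2)) :=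
        Finset.sum_le_sum fun x _ => hpt x
    _ = 2 * nsqOn Ω (LapS (fine n M) c *ᵥ z)
          + 4 * d * ‖c‖ ^ 4 * ∑ ν : Fin d, (ell1 n ^ 2 * ∑ x : Tor (fine n M), A ν x ^ 2 + ell2 n ^ 2 * ∑ x : Tor (fine n M), B ν x ^ 2) := by
        rw [Finset.sum_add_distrib, ← Finset.mul_sum, ← Finset.mul_sum, ← nsq_restrictTo, Finset.sum_comm]
        simp only [nsq, Finset.sum_add_distrib, Finset.mul_sum]
    _ ≤ 2 * nsqOn Ω (LapS (fine n M) c *ᵥ z)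
          + 4 * d * ‖c‖ ^ 4 * ∑ ν : Fin d, (ell1 n ^ 2 * (4 * ‖c‖⁻¹ ^ 2 * nsq (sdiff (fine n M) c ν *ᵥ z)) + ell2 n ^ 2 * nsq z) := by
        gcongr with ν
        · exact hAsum ν
        · exact (hBsum ν).le
    _ = 2 * nsqOn Ω (LapS (fine n M) c *ᵥ z) + 16 * d * ‖c‖ ^ 2 * ell1 n ^ 2 * energy (fine n M) c z
          + 4 * d ^ 2 * ‖c‖ ^ 4 * ell2 n ^ 2 * nsq z := by
        unfold energy
        rw [Finset.sum_add_distrib, ← Finset.mul_sum, ← Finset.mul_sum, Finset.sum_const, Finset.card_univ, Fintype.card_fin,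
          nsmul_eq_mul]
        have : 4 * (d : ℝ) * ‖c‖ ^ 4 * (ell1 n ^ 2 * (4 * ‖c‖⁻¹ ^ 2 * ∑ ν : Fin d, nsq (sdiff (fine n M) c ν *ᵥ z)))
            = 16 * d * (‖c‖ ^ 4 * ‖c‖⁻¹ ^ 2) * ell1 n ^ 2 * ∑ ν : Fin d, nsq (sdiff (fine n M) c ν *ᵥ z) := by ring
        rw [mul_add, this, hcc]; ring

end Sums

/-! ## §2 THE END: the localised one-sided Besov estimate -/

section End

variable (n : ℕ) [NeZero n] (M : Fin d → ℕ) [hM : ∀ μ, NeZero (M μ)]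

/-- **THE LOCALISED ONE-SIDED BESOV ESTIMATE (the END of «Δ1-LOCAL» file 2)**: for EVERY lattice field `z` supported in a region `Ω` that
is pointwise the block region of a block set `S` SPLITTABLE ALONG `μ` AT EVERY VERTEX (`2 ≤ n`, `c ≠ 0`),
`‖∂_μ∂_μ z‖² ≤ 24·2^d·‖c‖ · √(2E(z) + 2d‖c‖²ℓ₁²‖z‖²) · √(2‖1_ΩΔz‖² + 16d‖c‖²ℓ₁²E(z) + 4d²‖c‖⁴ℓ₂²‖z‖²)` with `ℓ₁ = 3/(n−1)`,
`ℓ₂ = 12/(n−1)²` — ONE power of `‖c‖` against the datum, no global cutoff, no convexity. [folklore] -/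
theorem nsq_sdiff_sdiff_le_of_splittable (hn : 2 ≤ n) {S : Tor M → Prop} {Ω : Tor (fine n M) → Prop} [DecidablePred Ω]
    (hΩ : ∀ x, Ω x ↔ S (blockOf n M x)) {μ : Fin d} (hS : ∀ v : Tor M, SplittableAt M S v μ) (c : ℂ) (hc : c ≠ 0)
    {z : Tor (fine n M) → ℂ} (hz : ∀ x, ¬ Ω x → z x = 0) :
    nsq (sdiff (fine n M) c μ *ᵥ (sdiff (fine n M) c μ *ᵥ z))
      ≤ 24 * 2 ^ d * ‖c‖ * Real.sqrt (2 * energy (fine n M) c z + 2 * d * ‖c‖ ^ 2 * ell1 n ^ 2 * nsq z)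
          * Real.sqrt (2 * nsqOn Ω (LapS (fine n M) c *ᵥ z) + 16 * d * ‖c‖ ^ 2 * ell1 n ^ 2 * energy (fine n M) c z
              + 4 * d ^ 2 * ‖c‖ ^ 4 * ell2 n ^ 2 * nsq z) := by
  -- `z = Σ_v f_v`, `∂∂z = Σ_v ∂∂f_v`
  set g : Tor M → Tor (fine n M) → ℂ := fun v => sdiff (fine n M) c μ *ᵥ (sdiff (fine n M) c μ *ᵥ vfield n M v z) with hg
  have hsum : sdiff (fine n M) c μ *ᵥ (sdiff (fine n M) c μ *ᵥ z) = ∑ v : Tor M, g v := by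
    have hz : z = ∑ v : Tor M, vfield n M v z := by
      funext x
      rw [Finset.sum_apply]
      simp only [vfield, cut, ← Finset.sum_mul, ← Complex.ofReal_sum, sum_bump n M x, Complex.ofReal_one, one_mul]
    conv_lhs => rw [hz]
    rw [Matrix.mulVec_sum, Matrix.mulVec_sum]
  rw [hsum]
  -- finite overlap
  have hover := nsq_sum_le_of_overlap g (tripleVerts n M μ) (3 * 2 ^ d)
    (fun x v h => mem_tripleVerts_of_ne_zero n M c μ h) (card_tripleVerts_le n M μ)
  refine hover.trans ?_
  -- each vertex
  set E : Tor M → ℝ := fun v => energy (fine n M) c (vfield n M v z) with hE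
  set R : Tor M → ℝ := fun v => nsqOn Ω (LapS (fine n M) c *ᵥ vfield n M v z) with hR
  have hv : ∀ v : Tor M, nsq (g v) ≤ 8 * ‖c‖ * (Real.sqrt (E v) * Real.sqrt (R v)) := fun v => by
    rw [← mul_assoc]; exact nsq_sdiff_sdiff_vfield_le n M hn hΩ c hc (hS v) hz
  have hE0 : ∀ v, 0 ≤ E v := fun v => energy_nonneg _ _ _
  have hR0 : ∀ v, 0 ≤ R v := fun v => nsqOn_nonneg _ _
  have hcs := sum_sqrt_mul_sqrt_le (Finset.univ : Finset (Tor M)) hE0 hR0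
  have hEs := sum_energy_vfield_le n M hn c z
  have hRs := sum_nsqOn_LapS_vfield_le n M hn Ω c hc z
  have h8 : 0 ≤ 8 * ‖c‖ := by positivity
  calc ((3 * 2 ^ d : ℕ) : ℝ) * ∑ v : Tor M, nsq (g v) ≤ ((3 * 2 ^ d : ℕ) : ℝ) * ∑ v : Tor M, 8 * ‖c‖ * (Real.sqrt (E v) * Real.sqrt (R v)) :=
        mul_le_mul_of_nonneg_left (Finset.sum_le_sum fun v _ => hv v) (Nat.cast_nonneg _)
    _ = 24 * 2 ^ d * ‖c‖ * ∑ v : Tor M, Real.sqrt (E v) * Real.sqrt (R v) := by rw [← Finset.mul_sum]; push_cast; ring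
    _ ≤ 24 * 2 ^ d * ‖c‖ * (Real.sqrt (∑ v : Tor M, E v) * Real.sqrt (∑ v : Tor M, R v)) :=
        mul_le_mul_of_nonneg_left hcs (by positivity)
    _ ≤ 24 * 2 ^ d * ‖c‖ * (Real.sqrt (2 * energy (fine n M) c z + 2 * d * ‖c‖ ^ 2 * ell1 n ^ 2 * nsq z)
          * Real.sqrt (2 * nsqOn Ω (LapS (fine n M) c *ᵥ z) + 16 * d * ‖c‖ ^ 2 * ell1 n ^ 2 * energy (fine n M) c z
              + 4 * d ^ 2 * ‖c‖ ^ 4 * ell2 n ^ 2 * nsq z)) := by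
        gcongr
    _ = _ := by ring

/-- **THE END, adjoint-sandwich form** `‖∂_μᴴ∂_μ z‖² ≤ …` — the quantity gan24-p2's two-level pairing bound (C-glob) consumes. [folklore] -/
theorem nsq_sdiffH_sdiff_le_of_splittable (hn : 2 ≤ n) {S : Tor M → Prop} {Ω : Tor (fine n M) → Prop} [DecidablePred Ω]
    (hΩ : ∀ x, Ω x ↔ S (blockOf n M x)) {μ : Fin d} (hS : ∀ v : Tor M, SplittableAt M S v μ) (c : ℂ) (hc : c ≠ 0)
    {z : Tor (fine n M) → ℂ} (hz : ∀ x, ¬ Ω x → z x = 0) :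
    nsq ((sdiff (fine n M) c μ)ᴴ *ᵥ (sdiff (fine n M) c μ *ᵥ z))
      ≤ 24 * 2 ^ d * ‖c‖ * Real.sqrt (2 * energy (fine n M) c z + 2 * d * ‖c‖ ^ 2 * ell1 n ^ 2 * nsq z)
          * Real.sqrt (2 * nsqOn Ω (LapS (fine n M) c *ᵥ z) + 16 * d * ‖c‖ ^ 2 * ell1 n ^ 2 * energy (fine n M) c z
              + 4 * d ^ 2 * ‖c‖ ^ 4 * ell2 n ^ 2 * nsq z) := by
  rw [nsq_sdiffH_sdiff_eq (fine n M) c hc]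
  exact nsq_sdiff_sdiff_le_of_splittable n M hn hΩ hS c hc hz

end End

end Summit.QuantumFields.BalabanUV.T4Continuum.DirichletLocalisedBesov

end
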